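import Mathlib
import Summits.ValiantsHypothesis.ValiantsHypothesis.Theorems.KPlusLogSqLawStepPartner

/-!
# The PARTNER LAW, left-moving steps (static path model behind `KPlusLogSqLaw.TropicalB`)

Cell pub-symmetroid, seat conjb-2 (g22). A helper toward the crux `TropicalB`
(`Summit.ValiantsHypothesis.ValiantsHypothesis.Theses.KPlusLogSqLaw.TropicalB`, item
`stmt-ValiantsHypothesis-19771`); it earns no crux credit and is not evidence for `MatrixDescartes` or for
Valiant's hypothesis.

The mirror images `θ ↦ -θ` of `KPlusLogSqLawStepPartner.partner_law_even` / `partner_law_odd` (THEORY-NOTE-g22 §3):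
rows `i` and `i+2` step to the LEFT with `T[i+2, i+d+2]` left of `T[i+1, i+d+1]`; the admissible partner bands are
reversed and the forbidden clause flips (`partner_law_even_mirror`: `s p < s q` forbidden with `p ≥ i+2`, `q ≤ i+d`;
`partner_law_odd_mirror`: `s q < s p`). Proofs: `partner_law_core` applied to the reflected lines `S_t(-θ)` (slopes
negated, `sep_refl`) resp. to `-S_t(-θ)` (`sep_negrefl`).
-/

set_option linter.dupNamespace false

namespace Summit.ValiantsHypothesis.ValiantsHypothesis.Theorems.KPlusLogSqLawStepPartnerMirror

open Summit.ValiantsHypothesis.ValiantsHypothesis.Theorems.KPlusLogSqLawStepPartner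
  (partner_law_core sep_refl sep_of_refl sep_negrefl sep_of_negrefl)

/-- PARTNER LAW, first line `i` even, three LEFT-moving steps (admissible partners: odd inner lines with
`s (i+d+1) < s p < s i`, `s (i+d+3) < s q < s (i+2)`; forbidden clause `s p < s q`). -/
theorem partner_law_even_mirror (s b : ℕ → ℝ) (i d : ℕ) (hi : Even i) (hd : Odd d)
    (hA0 : ∃ θ : ℝ, ∀ e o : ℕ, i ≤ e → e ≤ i + d → i ≤ o → o ≤ i + d → Even e → Odd o →
      b o + s o * θ < b e + s e * θ)
    (hB0 : ∃ θ : ℝ, ∀ e o : ℕ, i + 1 ≤ e → e ≤ i + d + 1 → i + 1 ≤ o → o ≤ i + d + 1 → Even e → Odd o →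
      b o + s o * θ < b e + s e * θ)
    (hord0 : ∀ θ θ' : ℝ, (∀ e o : ℕ, i ≤ e → e ≤ i + d → i ≤ o → o ≤ i + d → Even e → Odd o →
      b o + s o * θ < b e + s e * θ) → (∀ e o : ℕ, i + 1 ≤ e → e ≤ i + d + 1 → i + 1 ≤ o → o ≤ i + d + 1 →
      Even e → Odd o → b o + s o * θ' < b e + s e * θ') → θ' < θ)
    (hord1 : ∀ θ θ' : ℝ, (∀ e o : ℕ, i + 1 ≤ e → e ≤ i + d + 1 → i + 1 ≤ o → o ≤ i + d + 1 → Even e →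
      Odd o → b o + s o * θ < b e + s e * θ) → (∀ e o : ℕ, i + 2 ≤ e → e ≤ i + d + 2 → i + 2 ≤ o →
      o ≤ i + d + 2 → Even e → Odd o → b o + s o * θ' < b e + s e * θ') → θ' < θ)
    (hA2 : ∃ θ : ℝ, ∀ e o : ℕ, i + 2 ≤ e → e ≤ i + d + 2 → i + 2 ≤ o → o ≤ i + d + 2 → Even e → Odd o →
      b o + s o * θ < b e + s e * θ)
    (hB2 : ∃ θ : ℝ, ∀ e o : ℕ, i + 3 ≤ e → e ≤ i + d + 3 → i + 3 ≤ o → o ≤ i + d + 3 → Even e → Odd o →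
      b o + s o * θ < b e + s e * θ)
    (hord2 : ∀ θ θ' : ℝ, (∀ e o : ℕ, i + 2 ≤ e → e ≤ i + d + 2 → i + 2 ≤ o → o ≤ i + d + 2 → Even e →
      Odd o → b o + s o * θ < b e + s e * θ) → (∀ e o : ℕ, i + 3 ≤ e → e ≤ i + d + 3 → i + 3 ≤ o →
      o ≤ i + d + 3 → Even e → Odd o → b o + s o * θ' < b e + s e * θ') → θ' < θ)
    (hQ : ∀ p q : ℕ, i + 1 ≤ p → p ≤ i + d → Odd p → s (i + d + 1) < s p → s p < s i →
      i + 3 ≤ q → q ≤ i + d + 2 → Odd q → s (i + d + 3) < s q → s q < s (i + 2) →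
      i + 2 ≤ p ∧ q ≤ i + d ∧ s p < s q) :
    False := by
  have hd1 : 1 ≤ d := by
    obtain ⟨l, hl⟩ := hd
    omega
  have hi1 : ¬ Even (i + 1) := by
    obtain ⟨k, hk⟩ := hi
    exact Nat.not_even_iff_odd.mpr ⟨k, by omega⟩
  have hi3 : ¬ Even (i + 3) := by
    obtain ⟨k, hk⟩ := hi
    exact Nat.not_even_iff_odd.mpr ⟨k + 1, by omega⟩
  have hup1 : Even (i + d + 1) := by
    obtain ⟨k, hk⟩ := hi
    obtain ⟨l, hl⟩ := hd
    exact ⟨k + l + 1, by omega⟩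
  have hup2 : Even (i + 2) := by
    obtain ⟨k, hk⟩ := hi
    exact ⟨k + 1, by omega⟩
  have hup3 : Even (i + d + 3) := by
    obtain ⟨k, hk⟩ := hi
    obtain ⟨l, hl⟩ := hd
    exact ⟨k + l + 2, by omega⟩
  obtain ⟨θA, hθA⟩ := hA0
  obtain ⟨θB, hθB⟩ := hB0
  obtain ⟨θC, hθC⟩ := hA2
  obtain ⟨θD, hθD⟩ := hB2
  -- reflect `θ ↦ -θ`: slopes negated, steps now moving right
  exact partner_law_core (fun n => Even n) (fun t => -s t) b i d hi hup1 hup2 hup3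
    ⟨i + 1, le_rfl, by omega, hi1⟩ ⟨i + 3, le_rfl, by omega, hi3⟩
    ⟨-θA, sep_refl s b i (i + d) θA hθA⟩
    ⟨-θB, sep_refl s b (i + 1) (i + d + 1) θB hθB⟩
    (fun θ θ' hθ hθ' => by
      have := hord0 (-θ) (-θ') (sep_of_refl s b i (i + d) θ hθ) (sep_of_refl s b (i + 1) (i + d + 1) θ' hθ')
      linarith)
    (fun θ θ' hθ hθ' => by
      have := hord1 (-θ) (-θ') (sep_of_refl s b (i + 1) (i + d + 1) θ hθ)
        (sep_of_refl s b (i + 2) (i + d + 2) θ' hθ')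
      linarith)
    ⟨-θC, sep_refl s b (i + 2) (i + d + 2) θC hθC⟩
    ⟨-θD, sep_refl s b (i + 3) (i + d + 3) θD hθD⟩
    (fun θ θ' hθ hθ' => by
      have := hord2 (-θ) (-θ') (sep_of_refl s b (i + 2) (i + d + 2) θ hθ)
        (sep_of_refl s b (i + 3) (i + d + 3) θ' hθ')
      linarith)
    (fun p q g1 g2 gp g3 g4 g5 g6 gq g7 g8 => by
      obtain ⟨a1, a2, a3⟩ := hQ p q g1 g2 (Nat.not_even_iff_odd.mp gp) (by simpa using g4) (by simpa using g3)
        g5 g6 (Nat.not_even_iff_odd.mp gq) (by simpa using g8) (by simpa using g7)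
      exact ⟨a1, a2, by simpa using a3⟩)

/-- PARTNER LAW, first line `i` odd, three LEFT-moving steps (admissible partners: even inner lines with
`s i < s p < s (i+d+1)`, `s (i+2) < s q < s (i+d+3)`; forbidden clause `s q < s p`). -/
theorem partner_law_odd_mirror (s b : ℕ → ℝ) (i d : ℕ) (hi : Odd i) (hd : Odd d)
    (hA0 : ∃ θ : ℝ, ∀ e o : ℕ, i ≤ e → e ≤ i + d → i ≤ o → o ≤ i + d → Even e → Odd o →
      b o + s o * θ < b e + s e * θ)
    (hB0 : ∃ θ : ℝ, ∀ e o : ℕ, i + 1 ≤ e → e ≤ i + d + 1 → i + 1 ≤ o → o ≤ i + d + 1 → Even e → Odd o →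
      b o + s o * θ < b e + s e * θ)
    (hord0 : ∀ θ θ' : ℝ, (∀ e o : ℕ, i ≤ e → e ≤ i + d → i ≤ o → o ≤ i + d → Even e → Odd o →
      b o + s o * θ < b e + s e * θ) → (∀ e o : ℕ, i + 1 ≤ e → e ≤ i + d + 1 → i + 1 ≤ o → o ≤ i + d + 1 →
      Even e → Odd o → b o + s o * θ' < b e + s e * θ') → θ' < θ)
    (hord1 : ∀ θ θ' : ℝ, (∀ e o : ℕ, i + 1 ≤ e → e ≤ i + d + 1 → i + 1 ≤ o → o ≤ i + d + 1 → Even e →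
      Odd o → b o + s o * θ < b e + s e * θ) → (∀ e o : ℕ, i + 2 ≤ e → e ≤ i + d + 2 → i + 2 ≤ o →
      o ≤ i + d + 2 → Even e → Odd o → b o + s o * θ' < b e + s e * θ') → θ' < θ)
    (hA2 : ∃ θ : ℝ, ∀ e o : ℕ, i + 2 ≤ e → e ≤ i + d + 2 → i + 2 ≤ o → o ≤ i + d + 2 → Even e → Odd o →
      b o + s o * θ < b e + s e * θ)
    (hB2 : ∃ θ : ℝ, ∀ e o : ℕ, i + 3 ≤ e → e ≤ i + d + 3 → i + 3 ≤ o → o ≤ i + d + 3 → Even e → Odd o →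
      b o + s o * θ < b e + s e * θ)
    (hord2 : ∀ θ θ' : ℝ, (∀ e o : ℕ, i + 2 ≤ e → e ≤ i + d + 2 → i + 2 ≤ o → o ≤ i + d + 2 → Even e →
      Odd o → b o + s o * θ < b e + s e * θ) → (∀ e o : ℕ, i + 3 ≤ e → e ≤ i + d + 3 → i + 3 ≤ o →
      o ≤ i + d + 3 → Even e → Odd o → b o + s o * θ' < b e + s e * θ') → θ' < θ)
    (hQ : ∀ p q : ℕ, i + 1 ≤ p → p ≤ i + d → Even p → s i < s p → s p < s (i + d + 1) →
      i + 3 ≤ q → q ≤ i + d + 2 → Even q → s (i + 2) < s q → s q < s (i + d + 3) →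
      i + 2 ≤ p ∧ q ≤ i + d ∧ s q < s p) :
    False := by
  have hd1 : 1 ≤ d := by
    obtain ⟨l, hl⟩ := hd
    omega
  have hi1 : ¬ Odd (i + 1) := by
    obtain ⟨k, hk⟩ := hi
    exact Nat.not_odd_iff_even.mpr ⟨k + 1, by omega⟩
  have hi3 : ¬ Odd (i + 3) := by
    obtain ⟨k, hk⟩ := hi
    exact Nat.not_odd_iff_even.mpr ⟨k + 2, by omega⟩
  have hup1 : Odd (i + d + 1) := by
    obtain ⟨k, hk⟩ := hi
    obtain ⟨l, hl⟩ := hd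
    exact ⟨k + l + 1, by omega⟩
  have hup2 : Odd (i + 2) := by
    obtain ⟨k, hk⟩ := hi
    exact ⟨k + 1, by omega⟩
  have hup3 : Odd (i + d + 3) := by
    obtain ⟨k, hk⟩ := hi
    obtain ⟨l, hl⟩ := hd
    exact ⟨k + l + 2, by omega⟩
  obtain ⟨θA, hθA⟩ := hA0
  obtain ⟨θB, hθB⟩ := hB0
  obtain ⟨θC, hθC⟩ := hA2
  obtain ⟨θD, hθD⟩ := hB2
  -- `S_t(θ) ↦ -S_t(-θ)`: slopes kept, intercepts negated, odd lines upper, steps now moving right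
  exact partner_law_core (fun n => Odd n) s (fun t => -b t) i d hi hup1 hup2 hup3
    ⟨i + 1, le_rfl, by omega, hi1⟩ ⟨i + 3, le_rfl, by omega, hi3⟩
    ⟨-θA, sep_negrefl s b i (i + d) θA hθA⟩
    ⟨-θB, sep_negrefl s b (i + 1) (i + d + 1) θB hθB⟩
    (fun θ θ' hθ hθ' => by
      have := hord0 (-θ) (-θ') (sep_of_negrefl s b i (i + d) θ hθ)
        (sep_of_negrefl s b (i + 1) (i + d + 1) θ' hθ')
      linarith)
    (fun θ θ' hθ hθ' => by
      have := hord1 (-θ) (-θ') (sep_of_negrefl s b (i + 1) (i + d + 1) θ hθ)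
        (sep_of_negrefl s b (i + 2) (i + d + 2) θ' hθ')
      linarith)
    ⟨-θC, sep_negrefl s b (i + 2) (i + d + 2) θC hθC⟩
    ⟨-θD, sep_negrefl s b (i + 3) (i + d + 3) θD hθD⟩
    (fun θ θ' hθ hθ' => by
      have := hord2 (-θ) (-θ') (sep_of_negrefl s b (i + 2) (i + d + 2) θ hθ)
        (sep_of_negrefl s b (i + 3) (i + d + 3) θ' hθ')
      linarith)
    (fun p q g1 g2 gp g3 g4 g5 g6 gq g7 g8 => hQ p q g1 g2 (Nat.not_odd_iff_even.mp gp) g3 g4 g5 g6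
      (Nat.not_odd_iff_even.mp gq) g7 g8)

end Summit.ValiantsHypothesis.ValiantsHypothesis.Theorems.KPlusLogSqLawStepPartnerMirror
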